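import Literature.NumberTheory.EllipticCurves.BSDRootNumberSmallConductorProofs
import Literature.NumberTheory.EllipticCurves.TamagawaFiniteIndexProofs
import HarnessLib

/-!
# bsd.S31 (BSD for `E/ℚ` of rank `≤ 1` and conductor `< 5000`): assembly with the Tamagawa input discharged

Second sibling proof file of `Literature.NumberTheory.EllipticCurves.BSDRootNumber` for the named
fact `Literature.NumberTheory.EllipticCurves.bsdTriple_of_rank_le_one_of_conductor_lt`
(**bsd.S31**; Creutz–Miller, J. Algebra 372 (2012), Thm. 1.1 with the remark following it:
full BSD, RANK ∧ SHAFIN ∧ LEAD, for every elliptic curve `E/ℚ` of Mordell–Weil rank `≤ 1` and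
conductor `N_E < 5000`). The first sibling,
`Literature.NumberTheory.EllipticCurves.BSDRootNumberSmallConductorProofs`, reduces bsd.S31
sorry-free to seven inputs (`bsdTriple_of_rank_le_one_of_conductor_lt_of_bsdp`): Cremona's rank
verification for `N < 130000`, modularity, `L(E,1) ≥ 0`, Gross–Zagier in rank one, positivity of
the Tamagawa product, and the two printed `p`-part theorems of Miller 2011 / Creutz–Miller 2012.
Of these, the positivity of the Tamagawa product (`WeierstrassCurve.tamagawaProduct_pos`,
Silverman, *AEC*, Cor. VII.6.2) has since been **proved** in the tree
(`WeierstrassCurve.tamagawaProduct_pos_holds`, file `TamagawaFiniteIndexProofs`, by the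
compactness argument of Silverman's Exercise 7.6). This file feeds that theorem in, so that

* Miller's remark "Clearly the Birch and Swinnerton-Dyer conjecture holds if and only if for each
  prime `p`, `BSD(E/ℚ,p)` is true" (LMS J. Comput. Math. 14 (2011), §1) becomes a hypothesis-free
  theorem about every elliptic curve over `ℚ` in its precise form
  `bsdTriple_iff_forall_bsdp'`: RANK ∧ SHAFIN ∧ LEAD `↔` `#Ш_an > 0 ∧ ∀ p, BSD(E,p)`
  (likewise `bsdLeadingTermFormula_iff_shaAn_eq'`: LEAD `↔ #Ш_an = #Ш`);
* the printed theorem (Creutz–Miller, Thm. 1.1, analytic rank;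
  `bsdTriple_of_analyticRank_le_one_of_conductor_lt`) is reduced to **five** named facts
  (`bsdTriple_of_analyticRank_le_one_of_conductor_lt_of_bsdp'`) and is in fact *equivalent* to
  the conjunction of its two printed `p`-part theorems given modularity, `L(E,1) ≥ 0` and
  Gross–Zagier (`bsdTriple_of_analyticRank_le_one_of_conductor_lt_iff_bsdp`);
* bsd.S31 itself is reduced to **six** named facts
  (`bsdTriple_of_rank_le_one_of_conductor_lt_of_bsdp'`), each a precisely cited leaf:

  | leaf (named fact) | source | nature |
  |---|---|---|
  | `analyticRank_eq_mordellWeilRank_of_conductor_lt` | Cremona, ANTS VII (2006); as printed in Creutz–Miller 2012, §1 | rank tables, `N < 130000` |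
  | `WeierstrassCurve.hasEntireLFunction_rat` | Wiles 1995; Taylor–Wiles 1995; BCDT 2001, Thm. A | modularity |
  | `WeierstrassCurve.re_entireLFunction_one_nonneg` | Guo 1996; Lapid–Rallis 2003, Thm. 1 | `L(E,1) ≥ 0` |
  | `WeierstrassCurve.gross_zagier_rank_one_rat` | Gross–Zagier 1986, Thm. I.6.3 | `L'(E,1) = c · ĥ(P)` |
  | `bsdp_of_irreducible_of_conductor_lt` | Miller 2011, Thm. 1.2 (irreducible `E[p]`); Lawson–Wuthrich 2016, §5 | descents, Kato/Kolyvagin bounds |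
  | `bsdp_of_reducible_of_conductor_lt` | Miller 2011, Thm. 1.2 and §8; Miller–Stoll 2013, Thm. 9.1; Creutz–Miller 2012, §7.1 | isogeny descents (the eleven pairs of Table 1) |

  None of the six has a proof route in Mathlib or `Literature/` at present (Gross–Zagier–Kolyvagin,
  the Modularity Theorem, Kato's Euler system and the descent computations over the `17314`
  isogeny classes of conductor `< 5000`), so `bsdTriple_of_rank_le_one_of_conductor_lt_holds`
  stays open; this file records exactly what it is open *modulo*.

## Design choices

* Nothing of the first sibling is restated or renamed: the primed theorems here are its theorems
  with the hypothesis `hc : W.tamagawaProduct_pos` (resp. `∀ W, W.tamagawaProduct_pos`) fed by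
  `WeierstrassCurve.tamagawaProduct_pos_holds`; same namespace, `noncomputable section`,
  `open scoped Classical`.
* A separate file rather than an append: the first sibling does not import
  `TamagawaFiniteIndexProofs` (which postdates it), and its theorems keep their signatures for
  their importers.

## References

* B. Creutz, R. L. Miller, *Second isogeny descents and the Birch and Swinnerton-Dyer conjectural
  formula*, J. Algebra 372 (2012), 673–701, arXiv:1105.4018: Thm. 1.1 and the remark following
  it (arXiv pp. 3–4), Table 1, §7.1 (`CreutzMiller2012`).
* R. L. Miller, *Proving the Birch and Swinnerton-Dyer conjecture for specific elliptic curves of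
  analytic rank zero and one*, LMS J. Comput. Math. 14 (2011), 327–350, arXiv:1010.2431: §1,
  Def. 1.1, Thm. 1.2 (`Miller2011LMS`).
* R. L. Miller, M. Stoll, *Explicit isogeny descent on elliptic curves*, Math. Comp. 82 (2013),
  Thm. 9.1 (`MillerStoll2012`).
* T. Lawson, C. Wuthrich, *Vanishing of some Galois cohomology groups for elliptic curves*,
  Springer PROMS 188 (2016), §5, Thm. 14, Prop. 15 (`LawsonWuthrich2016`).
* J. E. Cremona, *The elliptic curve database for conductors to 130000*, ANTS VII, LNCS 4076
  (2006) (`Cremona2006`).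
* J. H. Silverman, *The Arithmetic of Elliptic Curves*, 2nd ed., Cor. VII.6.2 and Exercise 7.6
  (`SilvermanAEC2009`).
-/

noncomputable section

open scoped Classical

open WeierstrassCurve

namespace Literature.NumberTheory.EllipticCurves

/-! ### Miller's "BSD `↔ ∀ p, BSD(E,p)`", now hypothesis-free -/

section Equivalence

variable (W : WeierstrassCurve ℚ) [W.IsElliptic]

/-- **LEAD says `#Ш_an = #Ш`**, unconditionally for an elliptic curve `E/ℚ` with model `W`:
the leading-term formula `L^{(r)}(E,1)/r! = #Ш · Reg · Ω · ∏ c_p / #E(ℚ)_tors²`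
(`W.BSDLeadingTermFormula`) is equivalent to `#Ш(E/ℚ)_an = #Ш(E/ℚ)` (`shaAn W = W.shaOrder`).
This is `bsdLeadingTermFormula_iff_shaAn_eq` with its hypothesis `∏ c_p > 0` discharged by
`WeierstrassCurve.tamagawaProduct_pos_holds` (Silverman, *AEC*, Cor. VII.6.2). "`#Ш(ℚ,E)_an`,
the value of `#Ш(ℚ,E)` for which the conjectural formula holds" (Miller 2011, §1).
[cite: Miller2011LMS, §1 (arXiv:1010.2431 p. 3)] [cite: SilvermanAEC2009, Cor. VII.6.2] -/
theorem bsdLeadingTermFormula_iff_shaAn_eq' :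
    W.BSDLeadingTermFormula ↔ shaAn W = (W.shaOrder : ℂ) :=
  bsdLeadingTermFormula_iff_shaAn_eq W W.tamagawaProduct_pos_holds

/-- **BSD for `E` versus `BSD(E,p)` for all `p`, precisely and unconditionally** (Miller, LMS
J. Comput. Math. 14 (2011), §1: "Clearly the Birch and Swinnerton-Dyer conjecture holds if and
only if for each prime `p`, `BSD(E/ℚ,p)` is true"). For every elliptic curve `E/ℚ` with model
`W`: RANK ∧ SHAFIN ∧ LEAD (`W.BSDTriple`) holds iff `#Ш(E/ℚ)_an > 0` and `BSD(E,p)` (`BSDp W p`,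
Miller's Def. 1.1) holds for every prime `p`. The sign condition is what the valuations `ord_p`
cannot see and cannot be dropped; finiteness of `Ш` does follow from the right-hand side
(`shaFinite_of_forall_bsdp`). This is `bsdTriple_iff_forall_bsdp` with the Tamagawa input
discharged (`WeierstrassCurve.tamagawaProduct_pos_holds`).
[cite: Miller2011LMS, §1 and Def. 1.1 (arXiv:1010.2431 p. 3)] [cite: SilvermanAEC2009, Cor. VII.6.2] -/
theorem bsdTriple_iff_forall_bsdp' :
    W.BSDTriple ↔ 0 < (shaAn W).re ∧ ∀ p : ℕ, p.Prime → BSDp W p :=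
  bsdTriple_iff_forall_bsdp W W.tamagawaProduct_pos_holds

/-- **RANK ∧ SHAFIN ∧ LEAD from `BSD(E,p)` for all `p` and the sign of `#Ш_an`**
(`bsdTriple_of_forall_bsdp` with the Tamagawa input discharged).
[cite: Miller2011LMS, §1 and Def. 1.1 (arXiv:1010.2431 p. 3)] -/
theorem bsdTriple_of_forall_bsdp' (hpos : 0 < (shaAn W).re) (h : ∀ p : ℕ, p.Prime → BSDp W p) :
    W.BSDTriple :=
  bsdTriple_of_forall_bsdp W W.tamagawaProduct_pos_holds hpos h

/-- **`BSD(E,p)` for all `p` from RANK ∧ SHAFIN ∧ LEAD** (`forall_bsdp_of_bsdTriple` with the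
Tamagawa input discharged). [cite: Miller2011LMS, §1 and Def. 1.1 (arXiv:1010.2431 p. 3)] -/
theorem forall_bsdp_of_bsdTriple' (hBSD : W.BSDTriple) (p : ℕ) (hp : p.Prime) : BSDp W p :=
  forall_bsdp_of_bsdTriple W W.tamagawaProduct_pos_holds hBSD p hp

/-- **The sign of `#Ш_an` in analytic rank `≤ 1`** (`shaAn_re_pos_of_analyticRank_le_one` with
the Tamagawa input discharged): if `ord_{s=1} L(E,s) ≤ 1` and `#Ш(E/ℚ)_an` is rational, then
`#Ш(E/ℚ)_an > 0`, from modularity (`hasEntireLFunction_rat`, nonvanishing of the leading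
coefficient), `L(E,1) ≥ 0` (`re_entireLFunction_one_nonneg`; Guo 1996, Lapid–Rallis 2003) in
rank `0` and Gross–Zagier (`gross_zagier_rank_one_rat`, `L'(E,1) = c · ĥ(P)`, `c > 0`, `ĥ ≥ 0`)
in rank `1`. [cite: Miller2011LMS, §1 and §4 (arXiv:1010.2431 pp. 3, 10)]
[cite: LapidRallis2003, Thm. 1 (case n = 2)] [cite: GrossZagier1986, Thm. I.6.3 and §V.2] -/
theorem shaAn_re_pos_of_analyticRank_le_one' (hmod : hasEntireLFunction_rat)
    (hL0 : re_entireLFunction_one_nonneg) (hGZ : gross_zagier_rank_one_rat)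
    (hr : W.analyticRank ≤ 1) (hq : ∃ q : ℚ, shaAn W = q) : 0 < (shaAn W).re :=
  shaAn_re_pos_of_analyticRank_le_one W W.tamagawaProduct_pos_holds hmod hL0 hGZ hr hq

end Equivalence

/-! ### The printed theorem and bsd.S31 from their printed leaves -/

section Assembly

/-- **Creutz–Miller 2012, Thm. 1.1, from five named facts** (the printed theorem, analytic rank
`≤ 1` and `N_E < 5000`, assembled along its printed proof;
`bsdTriple_of_analyticRank_le_one_of_conductor_lt_of_bsdp` with the positivity of the Tamagawa
product discharged by `WeierstrassCurve.tamagawaProduct_pos_holds`). Inputs: modularity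
(`hasEntireLFunction_rat`), `L(E,1) ≥ 0` (`re_entireLFunction_one_nonneg`), Gross–Zagier in
rank one (`gross_zagier_rank_one_rat`) — these three only for the sign of `#Ш_an` — and the two
printed `p`-part theorems: Miller 2011, Thm. 1.2 for irreducible `E[p]`
(`bsdp_of_irreducible_of_conductor_lt`) and, for reducible `E[p]`, Miller's Thm. 1.2 with
Miller–Stoll 2013, Thm. 9.1 and the eleven pairs of Creutz–Miller 2012, Table 1 and §7.1
(`bsdp_of_reducible_of_conductor_lt`); the clause `rank = r_an` of `BSD(E,p)` is where
Gross–Zagier–Kolyvagin enters in print ("If `r_an(E/ℚ) ≤ 1` then it is known [Kolyvagin,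
modularity] that `r_an(E/ℚ)` is equal to the rank of `E(ℚ)` and `Ш(E/ℚ)` is finite",
Creutz–Miller 2012, §1). [cite: CreutzMiller2012, Thm. 1.1, Table 1 and §7.1 (arXiv:1105.4018 pp. 3–4, 19)]
[cite: Miller2011LMS, §1, Def. 1.1, Thm. 1.2] -/
theorem bsdTriple_of_analyticRank_le_one_of_conductor_lt_of_bsdp'
    (hmod : hasEntireLFunction_rat) (hL0 : re_entireLFunction_one_nonneg)
    (hGZ : gross_zagier_rank_one_rat)
    (hirr : bsdp_of_irreducible_of_conductor_lt) (hred : bsdp_of_reducible_of_conductor_lt) :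
    bsdTriple_of_analyticRank_le_one_of_conductor_lt :=
  bsdTriple_of_analyticRank_le_one_of_conductor_lt_of_bsdp hmod hL0 hGZ
    (fun W => W.tamagawaProduct_pos_holds) hirr hred

/-- **Conversely, the two `p`-part theorems from the printed theorem**, unconditionally
(`forall_bsdp_of_bsdTriple_of_analyticRank_le_one_of_conductor_lt` with the Tamagawa input
discharged): Creutz–Miller's Thm. 1.1 returns `BSD(E,p)` for every prime `p`, irreducible and
reducible `E[p]` alike. [cite: CreutzMiller2012, Thm. 1.1] [cite: Miller2011LMS, §1, Thm. 1.2] -/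
theorem forall_bsdp_of_bsdTriple_of_analyticRank_le_one_of_conductor_lt'
    (hBSD : bsdTriple_of_analyticRank_le_one_of_conductor_lt) :
    bsdp_of_irreducible_of_conductor_lt ∧ bsdp_of_reducible_of_conductor_lt :=
  forall_bsdp_of_bsdTriple_of_analyticRank_le_one_of_conductor_lt hBSD
    fun W => W.tamagawaProduct_pos_holds

/-- **The printed theorem is equivalent to its two printed `p`-parts**, given modularity,
`L(E,1) ≥ 0` and Gross–Zagier in rank one (which serve only to fix the sign of `#Ш_an`):
Creutz–Miller 2012, Thm. 1.1 `↔` (Miller 2011, Thm. 1.2, irreducible case) ∧ (Thm. 1.2, reducible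
case, completed by Miller–Stoll 2013, Thm. 9.1 and Creutz–Miller 2012, §7.1). This is the precise
content of "As an application we complete the proof of the following theorem" (Creutz–Miller
2012, §1) over the tree's definitions. [cite: CreutzMiller2012, Thm. 1.1 and §7.1]
[cite: Miller2011LMS, §1, Def. 1.1, Thm. 1.2] -/
theorem bsdTriple_of_analyticRank_le_one_of_conductor_lt_iff_bsdp
    (hmod : hasEntireLFunction_rat) (hL0 : re_entireLFunction_one_nonneg)
    (hGZ : gross_zagier_rank_one_rat) :
    bsdTriple_of_analyticRank_le_one_of_conductor_lt ↔
      bsdp_of_irreducible_of_conductor_lt ∧ bsdp_of_reducible_of_conductor_lt :=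
  ⟨forall_bsdp_of_bsdTriple_of_analyticRank_le_one_of_conductor_lt',
    fun h => bsdTriple_of_analyticRank_le_one_of_conductor_lt_of_bsdp' hmod hL0 hGZ h.1 h.2⟩

/-- **bsd.S31 from six named facts** (the statement file's
`bsdTriple_of_rank_le_one_of_conductor_lt`: Mordell–Weil rank `≤ 1`, `N_E < 5000`;
`bsdTriple_of_rank_le_one_of_conductor_lt_of_bsdp` with the positivity of the Tamagawa product
discharged). The six leaves: Cremona's verification of the rank conjecture for `N < 130000`
(`analyticRank_eq_mordellWeilRank_of_conductor_lt`; "Thus the hypothesis in Theorem 1.1 that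
`r_an(E/ℚ) ≤ 1` can be stated in terms of the algebraic rank instead", Creutz–Miller 2012, §1),
modularity (`hasEntireLFunction_rat`), `L(E,1) ≥ 0` (`re_entireLFunction_one_nonneg`),
Gross–Zagier in rank one (`gross_zagier_rank_one_rat`), and the two printed `p`-part theorems
(`bsdp_of_irreducible_of_conductor_lt`, `bsdp_of_reducible_of_conductor_lt`). This is the
current frontier of `bsdTriple_of_rank_le_one_of_conductor_lt_holds`: none of the six leaves has
a proof route in the tree. [cite: CreutzMiller2012, Thm. 1.1 and the remark following it (arXiv:1105.4018 pp. 3–4)]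
[cite: Miller2011LMS, §1, Def. 1.1, Thm. 1.2] [cite: Cremona2006, rank tables] -/
theorem bsdTriple_of_rank_le_one_of_conductor_lt_of_bsdp'
    (hrank : analyticRank_eq_mordellWeilRank_of_conductor_lt)
    (hmod : hasEntireLFunction_rat) (hL0 : re_entireLFunction_one_nonneg)
    (hGZ : gross_zagier_rank_one_rat)
    (hirr : bsdp_of_irreducible_of_conductor_lt) (hred : bsdp_of_reducible_of_conductor_lt) :
    bsdTriple_of_rank_le_one_of_conductor_lt :=
  bsdTriple_of_rank_le_one_of_conductor_lt_of hrank
    (bsdTriple_of_analyticRank_le_one_of_conductor_lt_of_bsdp' hmod hL0 hGZ hirr hred)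

/-- **bsd.S31, clause by clause, from the six leaves**: under them, an elliptic curve `E/ℚ` of
Mordell–Weil rank `≤ 1` and conductor `N_E < 5000`, given by a globally minimal model `W`,
satisfies `r_an = r`, `Ш(E/ℚ)` finite, `L^{(r)}(E,1)/r! = #Ш · Reg · Ω · ∏ c_p / #E(ℚ)_tors²`, and
moreover `#Ш(E/ℚ)_an = #Ш(E/ℚ)` and `BSD(E,p)` for every prime `p` (Creutz–Miller 2012, Thm. 1.1:
"`r_an(E/ℚ)` is equal to the rank of `E(ℚ)`, `Ш(E/ℚ)` is finite and [the formula]"; Miller 2011,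
Def. 1.1). [cite: CreutzMiller2012, Thm. 1.1 and the remark following it]
[cite: Miller2011LMS, §1, Def. 1.1] -/
theorem bsdTriple_of_rank_le_one_of_conductor_lt_clauses_of_bsdp
    (hrank : analyticRank_eq_mordellWeilRank_of_conductor_lt)
    (hmod : hasEntireLFunction_rat) (hL0 : re_entireLFunction_one_nonneg)
    (hGZ : gross_zagier_rank_one_rat)
    (hirr : bsdp_of_irreducible_of_conductor_lt) (hred : bsdp_of_reducible_of_conductor_lt)
    (W : WeierstrassCurve ℚ) [W.IsElliptic] [W.IsGloballyMinimal] (hr : W.mordellWeilRank ≤ 1)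
    (hN : W.conductorNorm ℤ < 5000) :
    W.analyticRank = W.mordellWeilRank ∧ W.ShaFinite ∧ W.leadingLCoeff = (W.bsdRHS : ℂ) ∧
      shaAn W = (W.shaOrder : ℂ) ∧ ∀ p : ℕ, p.Prime → BSDp W p := by
  have hBSD : W.BSDTriple :=
    bsdTriple_of_rank_le_one_of_conductor_lt_of_bsdp' hrank hmod hL0 hGZ hirr hred W hr hN
  exact ⟨hBSD.1, hBSD.2.1, hBSD.2.2, (bsdLeadingTermFormula_iff_shaAn_eq' W).1 hBSD.2.2,
    forall_bsdp_of_bsdTriple' W hBSD⟩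

end Assembly

end Literature.NumberTheory.EllipticCurves

end
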